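import Summits.CriticalPhenomena.SAWScalingLimit.Theorems.SAWDevelopingMapObservableToSLECanonicalTransferDictionary
import HarnessLib

/-!
# Crux `SAWDevelopingMap.ObservableToSLE` (stmt-CriticalPhenomena-10472), line
`floor-ratio-restriction-bootstrap`, stub `stub_canonicalTransfer`: the fixed-scale squeeze
(full lowest row)

Landing target:
`Summits/CriticalPhenomena/SAWScalingLimit/Theorems/SAWDevelopingMapObservableToSLECanonicalTransferSqueeze.lean`
(`--supports stmt-CriticalPhenomena-10472`).  Sequel of `…CanonicalTransferDictionary.lean`.

For a general floor Jordan domain `D` the canonical discrete domain `Ω_δ` of `HexSAW.lean` is not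
an admissible vertex domain, and neither is `Ω_δ ∩ Ω'` for a hull subdomain `D'` (bad honeycomb
edges, lattice-scale pockets).  The transfer `stub_canonicalTransfer` therefore runs through the
event `In = {γ ⊆ Λ ∪ {a, b}}` that the canonical walk stays inside an INNER admissible domain `Λ`
without bad edges, and squeezes the event `E` of the stub ("`γ` is an `Ω'`-mesh walk") on `In`
between two admissible `D'`-families `Λ' ⊆ Λ'' ⊆ Λ`: `Λ'` without bad `Ω'`-edges (from below) and
`Λ''` closed under `Ω'`-mesh steps inside `Λ` (from above).  This file is the fixed-scale part in
the case of a FULL lowest row (canonical endpoints `a, b ∈ Λ'`, entered through the vertical floor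
mid-edges `s_a = {a, u_a}`, `s_b = {b, u_b}`, `u_a, u_b ∉ Λ`):

* `support_subset_of_darts_closed` — a walk from a vertex of `S` all of whose steps lead from `S`
  into `S` stays in `S`;
* `sum_ite_inside_eq_sum` — `Σ_{γ canonical, γ ⊆ Λ ∪ {a,b}} x^{#vertices} = Z_Λ(s_a, s_b)`;
* `sum_le_sum_ite_meshEvent_inside` — `Z_{Λ'}(s_a, s_b) ≤ Σ_{γ canonical ∈ E ∩ In} x^{#vertices}`;
* `sum_ite_meshEvent_inside_le_sum` — `Σ_{γ canonical ∈ E ∩ In} x^{#vertices} ≤ Z_{Λ''}(s_a, s_b)`;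
* `stub_canonicalTransfer_squeeze` — the registered sub-goal: for the canonical law
  `P = hexSAWLaw Ω δ a b`, `P(In)·Z_{Λ'} ≤ P(E ∩ In)·Z_Λ` and `P(E ∩ In)·Z_Λ ≤ P(In)·Z_{Λ''}`.
-/

noncomputable section

open scoped BigOperators Classical ENNReal
open MeasureTheory
open Literature.Probability.LatticeModels (HexVertex hexGraph hexCenter)
open Literature.Probability.RandomPlanarGeometry
open Literature.Probability.RandomPlanarGeometry.SAW

namespace Summit.CriticalPhenomena.SAWScalingLimit.Theorems.ObservableToSLE.FloorRatio

/-! ### Walks in a set closed under their steps -/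

section Closed

variable {V : Type*} {G : SimpleGraph V}

/-- A walk starting in `S`, each of whose darts leads from `S` into `S`, stays in `S`. [folklore] -/
theorem support_subset_of_darts_closed {S : Set V} {u v : V} (p : G.Walk u v) (hu : u ∈ S)
    (h : ∀ d ∈ p.darts, d.fst ∈ S → d.snd ∈ S) : ∀ w ∈ p.support, w ∈ S := by
  induction p with
  | nil =>
    intro w hw
    rw [SimpleGraph.Walk.support_nil, List.mem_singleton] at hw
    exact hw ▸ hu
  | @cons x y z hadj q ih =>
    intro w hw
    rw [SimpleGraph.Walk.support_cons, List.mem_cons] at hw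
    rcases hw with rfl | hw
    · exact hu
    · have hy : y ∈ S :=
        h ⟨(x, y), hadj⟩ (by rw [SimpleGraph.Walk.darts_cons]; exact List.mem_cons.2 (Or.inl rfl)) hu
      refine ih hy (fun d hd => h d ?_) w hw
      rw [SimpleGraph.Walk.darts_cons]
      exact List.mem_cons_of_mem _ hd

end Closed

/-! ### The fixed-scale squeeze, full lowest row -/

section FullRow

variable {Ω Ω' : Set ℂ} {δ : ℝ} {Λ Λ' Λ'' : Finset HexVertex} {a b ua ub : HexVertex}

/-- **`Σ_{γ canonical, γ ⊆ Λ ∪ {a,b}} x^{#vertices(γ)} = Z_Λ(s_a, s_b)`.**  If every honeycomb edge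
inside `Λ` is an edge of `Ω_δ` and `a, b ∈ Λ`, `u_a, u_b ∉ Λ`, `s_a = {a,u_a} ≠ s_b = {b,u_b}`,
the canonical self-avoiding walks `a → b` of `Ω_δ` staying inside `Λ ∪ {a, b} = Λ` are in
vertex-list preserving bijection with the mid-edge walks `s_a → s_b` in `Λ`.
[cite: LawlerSchrammWerner2004SAW, §3.4 ("SAW satisfies restriction")] -/
theorem sum_ite_inside_eq_sum [Fintype (HexDomainSAW Ω δ a b)]
    (hΛ : ∀ v ∈ Λ, ∀ w ∈ Λ, hexGraph.Adj v w → (hexDomainGraph Ω δ).Adj v w)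
    (ha : a ∈ Λ) (hb : b ∈ Λ) (hua : ua ∉ Λ) (hub : ub ∉ Λ) (hadj : hexGraph.Adj a ua)
    (hne : s(a, ua) ≠ s(b, ub)) (x : ℝ) :
    (∑ γ : HexDomainSAW Ω δ a b,
        if ∀ v ∈ γ.walk.support, v ∈ Λ ∨ v = a ∨ v = b then x ^ γ.vertexCount else 0) =
      ∑ γ : HexMidEdgeSAW Λ s(a, ua) s(b, ub), x ^ γ.length := by
  obtain ⟨e₂, he₂⟩ := exists_equiv_isPath_of_le (embDomainGraph_le hexGraph hexCenter Ω δ)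
    (Λ := (↑Λ : Set HexVertex)) (fun v hv w hw h => hΛ v hv w hw h) a b
  obtain ⟨e₃, he₃⟩ := exists_equiv_isPath_hexMidEdgeSAW (vb := b) ha hua hub hadj hne
  have hIn : ∀ γ : HexDomainSAW Ω δ a b, (∀ v ∈ γ.walk.support, v ∈ Λ ∨ v = a ∨ v = b) ↔
      ∀ v ∈ γ.walk.support, v ∈ (↑Λ : Set HexVertex) := fun γ =>
    ⟨fun h v hv => (h v hv).elim id fun h' => h'.elim (fun h'' => h'' ▸ ha) fun h'' => h'' ▸ hb,
      fun h v hv => Or.inl (h v hv)⟩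
  let e₀ : {γ : HexDomainSAW Ω δ a b // ∀ v ∈ γ.walk.support, v ∈ Λ ∨ v = a ∨ v = b} ≃
      {p : (hexDomainGraph Ω δ).Walk a b // p.IsPath ∧ ∀ w ∈ p.support,
        w ∈ (↑Λ : Set HexVertex)} :=
    ⟨fun γ => ⟨γ.1.walk, γ.1.isPath, (hIn γ.1).1 γ.2⟩, fun p => ⟨⟨p.1, p.2.1⟩, (hIn _).2 p.2.2⟩,
      fun _ => rfl, fun _ => rfl⟩
  rw [← Finset.sum_filter, Finset.sum_subtype (Finset.univ.filter fun γ : HexDomainSAW Ω δ a b =>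
      ∀ v ∈ γ.walk.support, v ∈ Λ ∨ v = a ∨ v = b)
    (p := fun γ : HexDomainSAW Ω δ a b => ∀ v ∈ γ.walk.support, v ∈ Λ ∨ v = a ∨ v = b)
    (fun γ => by simp)]
  refine Fintype.sum_equiv (e₀.trans (e₂.trans e₃)) _ _ fun γ => ?_
  have hlen : (e₃ (e₂ (e₀ γ))).length = γ.1.vertexCount := by
    rw [HexMidEdgeSAW.length, he₃, he₂, SimpleGraph.Walk.length_support]
    rfl
  rw [Equiv.trans_apply, Equiv.trans_apply, hlen]

/-- **`Z_{Λ'}(s_a, s_b) ≤ Σ_{γ canonical ∈ E ∩ In} x^{#vertices(γ)}`** (`x ≥ 0`).  If `Λ' ⊆ Λ`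
has all its vertices in `Ω'` and all its inner honeycomb edges are `Ω'`-mesh edges, while every
honeycomb edge inside `Λ` is an edge of `Ω_δ`, then the mid-edge walks `s_a → s_b` in `Λ'`
(`a ∈ Λ'`, `u_a, u_b ∉ Λ`) inject into the canonical walks `a → b` of `Ω_δ` that are `Ω'`-mesh
walks (event `E` of `stub_canonicalTransfer`) and stay in `Λ ∪ {a, b}` (event `In`).
[cite: LawlerSchrammWerner2004SAW, §3.4 ("SAW satisfies restriction")] -/
theorem sum_le_sum_ite_meshEvent_inside [Fintype (HexDomainSAW Ω δ a b)]
    (hΛ : ∀ v ∈ Λ, ∀ w ∈ Λ, hexGraph.Adj v w → (hexDomainGraph Ω δ).Adj v w)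
    (hsub : Λ' ⊆ Λ) (hΛ'v : ∀ v ∈ Λ', v ∈ embMeshVertices hexCenter Ω' δ)
    (hΛ'e : ∀ v ∈ Λ', ∀ w ∈ Λ', hexGraph.Adj v w →
      (embMeshGraph hexGraph hexCenter Ω' δ).Adj v w)
    (ha : a ∈ Λ') (hua : ua ∉ Λ) (hub : ub ∉ Λ) (hadj : hexGraph.Adj a ua)
    (hne : s(a, ua) ≠ s(b, ub)) {x : ℝ} (hx : 0 ≤ x) :
    ∑ γ : HexMidEdgeSAW Λ' s(a, ua) s(b, ub), x ^ γ.length ≤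
      ∑ γ : HexDomainSAW Ω δ a b,
        if ((∀ v ∈ γ.walk.support, v ∈ embMeshVertices hexCenter Ω' δ) ∧
              ∀ e ∈ γ.walk.darts, (embMeshGraph hexGraph hexCenter Ω' δ).Adj e.fst e.snd) ∧
            ∀ v ∈ γ.walk.support, v ∈ Λ ∨ v = a ∨ v = b
        then x ^ γ.vertexCount else 0 := by
  obtain ⟨e₂, he₂⟩ := exists_equiv_isPath_of_le (embDomainGraph_le hexGraph hexCenter Ω δ)
    (Λ := (↑Λ' : Set HexVertex)) (fun v hv w hw h => hΛ v (hsub hv) w (hsub hw) h) a b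
  obtain ⟨e₃, he₃⟩ := exists_equiv_isPath_hexMidEdgeSAW (vb := b) ha (fun h => hua (hsub h))
    (fun h => hub (hsub h)) hadj hne
  -- the injection `ι = forget ∘ e₂⁻¹ ∘ e₃⁻¹`
  let ι : HexMidEdgeSAW Λ' s(a, ua) s(b, ub) → HexDomainSAW Ω δ a b := fun γ =>
    ⟨(e₂.symm (e₃.symm γ)).1, (e₂.symm (e₃.symm γ)).2.1⟩
  have hιΛ' : ∀ γ, ∀ w ∈ (ι γ).walk.support, w ∈ Λ' := fun γ w hw =>
    (e₂.symm (e₃.symm γ)).2.2 w hw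
  have hι : ∀ γ, (ι γ).walk.support = γ.verts := fun γ => by
    have h3 := he₃ (e₃.symm γ)
    rw [Equiv.apply_symm_apply] at h3
    have h2 := he₂ (e₂.symm (e₃.symm γ))
    rw [Equiv.apply_symm_apply] at h2
    rw [h3, h2]
  have hinj : Function.Injective ι := fun γ₁ γ₂ h =>
    HexMidEdgeSAW.ext (by rw [← hι, ← hι, h])
  have hlen : ∀ γ, (ι γ).vertexCount = γ.length := fun γ => by
    rw [HexMidEdgeSAW.length, ← hι, SimpleGraph.Walk.length_support]
    rfl
  -- the image lies in `E ∩ In`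
  have himg : ∀ γ, ((∀ v ∈ (ι γ).walk.support, v ∈ embMeshVertices hexCenter Ω' δ) ∧
      ∀ e ∈ (ι γ).walk.darts, (embMeshGraph hexGraph hexCenter Ω' δ).Adj e.fst e.snd) ∧
      ∀ v ∈ (ι γ).walk.support, v ∈ Λ ∨ v = a ∨ v = b := fun γ =>
    ⟨⟨fun v hv => hΛ'v v (hιΛ' γ v hv), fun e he =>
      hΛ'e _ (hιΛ' γ _ ((ι γ).walk.dart_fst_mem_support_of_mem_darts he)) _
        (hιΛ' γ _ ((ι γ).walk.dart_snd_mem_support_of_mem_darts he))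
        (embDomainGraph_le hexGraph hexCenter Ω δ e.adj)⟩,
      fun v hv => Or.inl (hsub (hιΛ' γ v hv))⟩
  rw [← Finset.sum_filter]
  calc ∑ γ : HexMidEdgeSAW Λ' s(a, ua) s(b, ub), x ^ γ.length
      = ∑ γ : HexMidEdgeSAW Λ' s(a, ua) s(b, ub), x ^ (ι γ).vertexCount :=
        Fintype.sum_congr _ _ fun γ => by rw [hlen]
    _ = ∑ γ ∈ Finset.univ.map ⟨ι, hinj⟩, x ^ γ.vertexCount := by
        rw [Finset.sum_map]; rfl
    _ ≤ _ := by
        refine Finset.sum_le_sum_of_subset_of_nonneg (fun γ hγ => ?_) fun γ _ _ => pow_nonneg hx _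
        rw [Finset.mem_map] at hγ
        obtain ⟨γ', -, rfl⟩ := hγ
        rw [Finset.mem_filter]
        exact ⟨Finset.mem_univ _, himg γ'⟩

/-- **`Σ_{γ canonical ∈ E ∩ In} x^{#vertices(γ)} ≤ Z_{Λ''}(s_a, s_b)`** (`x ≥ 0`).  If
`a ∈ Λ'' ⊆ Λ ∋ b` and `Λ''` is closed under `Ω'`-mesh steps inside `Λ` (a vertex of `Λ ∩ Ω'`
joined to a vertex of `Λ''` by an `Ω'`-mesh edge lies in `Λ''`), then a canonical walk `a → b`
in the event `E ∩ In` is an `Ω'`-mesh walk inside `Λ` from `a`, hence stays in `Λ''`, and these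
walks inject into the mid-edge walks `s_a → s_b` in `Λ''` (`u_a, u_b ∉ Λ`).
[cite: LawlerSchrammWerner2004SAW, §3.4 ("SAW satisfies restriction")] -/
theorem sum_ite_meshEvent_inside_le_sum [Fintype (HexDomainSAW Ω δ a b)]
    (hsub : Λ'' ⊆ Λ)
    (hcl : ∀ v ∈ Λ'', ∀ w ∈ Λ, w ∈ embMeshVertices hexCenter Ω' δ →
      (embMeshGraph hexGraph hexCenter Ω' δ).Adj v w → w ∈ Λ'')
    (ha : a ∈ Λ'') (hb : b ∈ Λ) (hua : ua ∉ Λ) (hub : ub ∉ Λ) (hadj : hexGraph.Adj a ua)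
    (hne : s(a, ua) ≠ s(b, ub)) {x : ℝ} (hx : 0 ≤ x) :
    (∑ γ : HexDomainSAW Ω δ a b,
        if ((∀ v ∈ γ.walk.support, v ∈ embMeshVertices hexCenter Ω' δ) ∧
              ∀ e ∈ γ.walk.darts, (embMeshGraph hexGraph hexCenter Ω' δ).Adj e.fst e.snd) ∧
            ∀ v ∈ γ.walk.support, v ∈ Λ ∨ v = a ∨ v = b
        then x ^ γ.vertexCount else 0) ≤
      ∑ γ : HexMidEdgeSAW Λ'' s(a, ua) s(b, ub), x ^ γ.length := by
  set S := Finset.univ.filter fun γ : HexDomainSAW Ω δ a b =>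
    ((∀ v ∈ γ.walk.support, v ∈ embMeshVertices hexCenter Ω' δ) ∧
        ∀ e ∈ γ.walk.darts, (embMeshGraph hexGraph hexCenter Ω' δ).Adj e.fst e.snd) ∧
      ∀ v ∈ γ.walk.support, v ∈ Λ ∨ v = a ∨ v = b with hS
  obtain ⟨e₃, he₃⟩ := exists_equiv_isPath_hexMidEdgeSAW (vb := b) ha (fun h => hua (hsub h))
    (fun h => hub (hsub h)) hadj hne
  -- walks of the event stay in `Λ''`
  have hsupp : ∀ γ : ↥S, ∀ w ∈ (γ.1.walk.mapLe (embDomainGraph_le hexGraph hexCenter Ω δ)).support,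
      w ∈ Λ'' := by
    rintro ⟨γ, hγ⟩ w hw
    rw [SimpleGraph.Walk.support_mapLe_eq_support] at hw
    rw [hS, Finset.mem_filter] at hγ
    obtain ⟨-, ⟨hEv, hEe⟩, hIn⟩ := hγ
    have hInΛ : ∀ v ∈ γ.walk.support, v ∈ Λ := fun v hv =>
      (hIn v hv).elim id fun h' => h'.elim (fun h'' => h'' ▸ hsub ha) fun h'' => h'' ▸ hb
    refine support_subset_of_darts_closed (S := (↑Λ'' : Set HexVertex)) γ.walk ha
      (fun d hd hd1 => ?_) w hw
    exact hcl _ hd1 _ (hInΛ _ (γ.walk.dart_snd_mem_support_of_mem_darts hd))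
      (hEv _ (γ.walk.dart_snd_mem_support_of_mem_darts hd)) (hEe d hd)
  let ι : ↥S → HexMidEdgeSAW Λ'' s(a, ua) s(b, ub) := fun γ =>
    e₃ ⟨γ.1.walk.mapLe (embDomainGraph_le hexGraph hexCenter Ω δ),
      (SimpleGraph.Walk.isPath_mapLe _).2 γ.1.isPath, hsupp γ⟩
  have hι : ∀ γ, (ι γ).verts = γ.1.walk.support := fun γ => by
    simp only [ι, he₃, SimpleGraph.Walk.support_mapLe_eq_support]
  have hinj : Function.Injective ι := by
    intro γ₁ γ₂ h
    have h' : γ₁.1.walk.support = γ₂.1.walk.support := by rw [← hι, ← hι, h]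
    obtain ⟨⟨w₁, hw₁⟩, h₁⟩ := γ₁
    obtain ⟨⟨w₂, hw₂⟩, h₂⟩ := γ₂
    obtain rfl : w₁ = w₂ := SimpleGraph.Walk.ext_support h'
    rfl
  have hlen : ∀ γ, (ι γ).length = γ.1.vertexCount := fun γ => by
    rw [HexMidEdgeSAW.length, hι, SimpleGraph.Walk.length_support]
    rfl
  rw [← Finset.sum_filter]
  calc ∑ γ ∈ S, x ^ γ.vertexCount
      = ∑ γ : ↥S, x ^ (ι γ).length := by
        rw [← Finset.sum_coe_sort]
        exact Fintype.sum_congr _ _ fun γ => by rw [hlen]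
    _ = ∑ γ ∈ Finset.univ.map ⟨ι, hinj⟩, x ^ γ.length := by
        rw [Finset.sum_map]; rfl
    _ ≤ ∑ γ : HexMidEdgeSAW Λ'' s(a, ua) s(b, ub), x ^ γ.length :=
        Finset.sum_le_sum_of_subset_of_nonneg (Finset.subset_univ _)
          fun γ _ _ => pow_nonneg hx _

/-- **The fixed-scale squeeze, full lowest row** (named-hypotheses form of the registered sub-goal
`stub_canonicalTransfer_squeeze`).  Let `Λ' ⊆ Λ'' ⊆ Λ` be finite vertex sets with: every
honeycomb edge inside `Λ` an edge of `Ω_δ` (inner domain without bad edges); `Λ' ⊆ Ω'` with all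
inner honeycomb edges `Ω'`-mesh edges; `Λ''` closed under `Ω'`-mesh steps inside `Λ`; and let
`a, b ∈ Λ'`, `u_a, u_b ∉ Λ`, `a ∼ u_a`, `s_a = {a,u_a} ≠ s_b = {b,u_b}`.  Then for the canonical
law `P = hexSAWLaw Ω δ a b`, the event `E` of `stub_canonicalTransfer` and `In = {γ ⊆ Λ ∪ {a,b}}`:
`P(In)·Z_{Λ'}(s_a,s_b) ≤ P(E ∩ In)·Z_Λ(s_a,s_b)` and `P(E ∩ In)·Z_Λ(s_a,s_b) ≤ P(In)·Z_{Λ''}(s_a,s_b)`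
(i.e. `Z_{Λ'}/Z_Λ ≤ P(E | In) ≤ Z_{Λ''}/Z_Λ`).
[cite: LawlerSchrammWerner2004SAW, §3.4 ("SAW satisfies restriction")] -/
theorem measure_meshEvent_inter_inside_squeeze [Fintype (HexDomainSAW Ω δ a b)]
    (hΛ : ∀ v ∈ Λ, ∀ w ∈ Λ, hexGraph.Adj v w → (hexDomainGraph Ω δ).Adj v w)
    (hsub' : Λ' ⊆ Λ'') (hsub : Λ'' ⊆ Λ)
    (hΛ'v : ∀ v ∈ Λ', v ∈ embMeshVertices hexCenter Ω' δ)
    (hΛ'e : ∀ v ∈ Λ', ∀ w ∈ Λ', hexGraph.Adj v w →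
      (embMeshGraph hexGraph hexCenter Ω' δ).Adj v w)
    (hcl : ∀ v ∈ Λ'', ∀ w ∈ Λ, w ∈ embMeshVertices hexCenter Ω' δ →
      (embMeshGraph hexGraph hexCenter Ω' δ).Adj v w → w ∈ Λ'')
    (ha : a ∈ Λ') (hb : b ∈ Λ') (hua : ua ∉ Λ) (hub : ub ∉ Λ) (hadj : hexGraph.Adj a ua)
    (hne : s(a, ua) ≠ s(b, ub)) :
    ((hexSAWLaw Ω δ a b) {γ | ∀ v ∈ γ.walk.support, v ∈ Λ ∨ v = a ∨ v = b}).toReal *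
          ∑ γ : HexMidEdgeSAW Λ' s(a, ua) s(b, ub), hexCriticalFugacity ^ γ.length ≤
        ((hexSAWLaw Ω δ a b)
            ({γ | (∀ v ∈ γ.walk.support, v ∈ embMeshVertices hexCenter Ω' δ) ∧
                ∀ e ∈ γ.walk.darts, (embMeshGraph hexGraph hexCenter Ω' δ).Adj e.fst e.snd} ∩
              {γ | ∀ v ∈ γ.walk.support, v ∈ Λ ∨ v = a ∨ v = b})).toReal *
          ∑ γ : HexMidEdgeSAW Λ s(a, ua) s(b, ub), hexCriticalFugacity ^ γ.length ∧
      ((hexSAWLaw Ω δ a b)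
            ({γ | (∀ v ∈ γ.walk.support, v ∈ embMeshVertices hexCenter Ω' δ) ∧
                ∀ e ∈ γ.walk.darts, (embMeshGraph hexGraph hexCenter Ω' δ).Adj e.fst e.snd} ∩
              {γ | ∀ v ∈ γ.walk.support, v ∈ Λ ∨ v = a ∨ v = b})).toReal *
          ∑ γ : HexMidEdgeSAW Λ s(a, ua) s(b, ub), hexCriticalFugacity ^ γ.length ≤
        ((hexSAWLaw Ω δ a b) {γ | ∀ v ∈ γ.walk.support, v ∈ Λ ∨ v = a ∨ v = b}).toReal *
          ∑ γ : HexMidEdgeSAW Λ'' s(a, ua) s(b, ub), hexCriticalFugacity ^ γ.length := by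
  have hx := hexCriticalFugacity_pos_lt_one.1.le
  -- the two probabilities as ratios
  have hIn : ((hexSAWLaw Ω δ a b) {γ | ∀ v ∈ γ.walk.support, v ∈ Λ ∨ v = a ∨ v = b}).toReal =
      (∑ γ : HexMidEdgeSAW Λ s(a, ua) s(b, ub), hexCriticalFugacity ^ γ.length) /
        ∑ γ : HexDomainSAW Ω δ a b, hexCriticalFugacity ^ γ.vertexCount := by
    rw [hexSAWLaw_apply_toReal_eq_div, ← sum_ite_inside_eq_sum hΛ (hsub (hsub' ha))
      (hsub (hsub' hb)) hua hub hadj hne, ← Finset.sum_filter]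
    congr 1
    refine Finset.sum_congr ?_ fun _ _ => rfl
    ext γ
    simp only [Finset.mem_filter, Finset.mem_univ, true_and, Set.mem_setOf_eq]
  have hEIn : ((hexSAWLaw Ω δ a b)
      ({γ | (∀ v ∈ γ.walk.support, v ∈ embMeshVertices hexCenter Ω' δ) ∧
          ∀ e ∈ γ.walk.darts, (embMeshGraph hexGraph hexCenter Ω' δ).Adj e.fst e.snd} ∩
        {γ | ∀ v ∈ γ.walk.support, v ∈ Λ ∨ v = a ∨ v = b})).toReal =
      (∑ γ : HexDomainSAW Ω δ a b,
        if ((∀ v ∈ γ.walk.support, v ∈ embMeshVertices hexCenter Ω' δ) ∧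
              ∀ e ∈ γ.walk.darts, (embMeshGraph hexGraph hexCenter Ω' δ).Adj e.fst e.snd) ∧
            ∀ v ∈ γ.walk.support, v ∈ Λ ∨ v = a ∨ v = b
        then hexCriticalFugacity ^ γ.vertexCount else 0) /
        ∑ γ : HexDomainSAW Ω δ a b, hexCriticalFugacity ^ γ.vertexCount := by
    rw [hexSAWLaw_apply_toReal_eq_div, ← Finset.sum_filter]
    congr 1
    refine Finset.sum_congr ?_ fun _ _ => rfl
    ext γ
    simp only [Finset.mem_filter, Finset.mem_univ, true_and, Set.mem_setOf_eq, Set.mem_inter_iff]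
  have hlow := sum_le_sum_ite_meshEvent_inside hΛ (hsub'.trans hsub) hΛ'v hΛ'e ha hua hub hadj
    hne hx
  have hup := sum_ite_meshEvent_inside_le_sum (Ω := Ω) (Ω' := Ω') (δ := δ) hsub hcl (hsub' ha)
    (hsub (hsub' hb)) hua hub hadj hne hx
  have hZc : 0 ≤ ∑ γ : HexDomainSAW Ω δ a b, hexCriticalFugacity ^ γ.vertexCount :=
    Finset.sum_nonneg fun γ _ => pow_nonneg hx _
  have hZΛ : 0 ≤ ∑ γ : HexMidEdgeSAW Λ s(a, ua) s(b, ub), hexCriticalFugacity ^ γ.length :=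
    Finset.sum_nonneg fun γ _ => pow_nonneg hx _
  rw [hIn, hEIn]
  rcases hZc.eq_or_lt with h0 | hpos
  · rw [← h0]; simp
  · constructor
    · rw [div_mul_eq_mul_div, div_mul_eq_mul_div, div_le_div_iff_of_pos_right hpos, mul_comm]
      exact mul_le_mul_of_nonneg_right hlow hZΛ
    · rw [div_mul_eq_mul_div, div_mul_eq_mul_div, div_le_div_iff_of_pos_right hpos, mul_comm]
      exact mul_le_mul_of_nonneg_left hup hZΛ

/-- **Registered sub-goal `stub_canonicalTransfer_squeeze`** (crux item stmt-CriticalPhenomena-10472,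
line `floor-ratio-restriction-bootstrap`, stub `stub_canonicalTransfer`): THE FIXED-SCALE SQUEEZE in
the case of a full lowest row, registry form of `measure_meshEvent_inter_inside_squeeze`.
[cite: LawlerSchrammWerner2004SAW, §3.4 ("SAW satisfies restriction")] -/
theorem stub_canonicalTransfer_squeeze :
    ∀ (Ω Ω' : Set ℂ) (δ : ℝ) (Λ Λ' Λ'' : Finset HexVertex) (a b ua ub : HexVertex)
    [Fintype (HexDomainSAW Ω δ a b)],
    (∀ v ∈ Λ, ∀ w ∈ Λ, hexGraph.Adj v w → (hexDomainGraph Ω δ).Adj v w) →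
    Λ' ⊆ Λ'' → Λ'' ⊆ Λ → (∀ v ∈ Λ', v ∈ embMeshVertices hexCenter Ω' δ) →
    (∀ v ∈ Λ', ∀ w ∈ Λ', hexGraph.Adj v w → (embMeshGraph hexGraph hexCenter Ω' δ).Adj v w) →
    (∀ v ∈ Λ'', ∀ w ∈ Λ, w ∈ embMeshVertices hexCenter Ω' δ →
      (embMeshGraph hexGraph hexCenter Ω' δ).Adj v w → w ∈ Λ'') →
    a ∈ Λ' → b ∈ Λ' → ua ∉ Λ → ub ∉ Λ → hexGraph.Adj a ua → s(a, ua) ≠ s(b, ub) →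
    ((hexSAWLaw Ω δ a b) {γ | ∀ v ∈ γ.walk.support, v ∈ Λ ∨ v = a ∨ v = b}).toReal *
          ∑ γ : HexMidEdgeSAW Λ' s(a, ua) s(b, ub), hexCriticalFugacity ^ γ.length ≤
        ((hexSAWLaw Ω δ a b)
            ({γ | (∀ v ∈ γ.walk.support, v ∈ embMeshVertices hexCenter Ω' δ) ∧
                ∀ e ∈ γ.walk.darts, (embMeshGraph hexGraph hexCenter Ω' δ).Adj e.fst e.snd} ∩
              {γ | ∀ v ∈ γ.walk.support, v ∈ Λ ∨ v = a ∨ v = b})).toReal *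
          ∑ γ : HexMidEdgeSAW Λ s(a, ua) s(b, ub), hexCriticalFugacity ^ γ.length ∧
      ((hexSAWLaw Ω δ a b)
            ({γ | (∀ v ∈ γ.walk.support, v ∈ embMeshVertices hexCenter Ω' δ) ∧
                ∀ e ∈ γ.walk.darts, (embMeshGraph hexGraph hexCenter Ω' δ).Adj e.fst e.snd} ∩
              {γ | ∀ v ∈ γ.walk.support, v ∈ Λ ∨ v = a ∨ v = b})).toReal *
          ∑ γ : HexMidEdgeSAW Λ s(a, ua) s(b, ub), hexCriticalFugacity ^ γ.length ≤
        ((hexSAWLaw Ω δ a b) {γ | ∀ v ∈ γ.walk.support, v ∈ Λ ∨ v = a ∨ v = b}).toReal *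
          ∑ γ : HexMidEdgeSAW Λ'' s(a, ua) s(b, ub), hexCriticalFugacity ^ γ.length :=
  fun _ _ _ _ _ _ _ _ _ _ _ hΛ hsub' hsub hΛ'v hΛ'e hcl ha hb hua hub hadj hne =>
    measure_meshEvent_inter_inside_squeeze hΛ hsub' hsub hΛ'v hΛ'e hcl ha hb hua hub hadj hne

end FullRow

end Summit.CriticalPhenomena.SAWScalingLimit.Theorems.ObservableToSLE.FloorRatio

end
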